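import Summits.ValiantsHypothesis.ValiantsHypothesis.Theorems.LacunarySymmetroidMatrixDescartesCensusDoorA34SheetSemidefBranches

/-!
# `MatrixDescartes` census — DOOR A at `(3,4)`: the CORE SHADOW on the semidefinite sheet — at a middle-type det-root of `G + s·(vvᵀ + wwᵀ)` (`s ≥ 0`)
# the three-letter core `G` has NO positive-definite 2-frame (Loewner monotonicity `F ⪰ G` in exact inertia language)

HONEST FRAMING.  Object-search cell `pub-symmetroid`, engine seat `val-sym-eng-2` (g9); helper row beside the registered strata line
`Cruxes/DoorA34/Lines/strata.lean` on stmt-ValiantsHypothesis-19980 (`DoorA34 = PosRootLawAt 3 4 18`: OPEN, typed, never asserted here), stub `stub_nullTopCeiling`,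
SEMIDEFINITE inertia cell of the singular top letter (`S₃ = vvᵀ + wwᵀ`, scale `s ≥ 0`; `s ≤ 0` is the `S₃ ⪯ 0` half).  Companion of …SheetSemidefBranches (the two
Schur branches are the two root types).  Here the other exact root-level fact of the cell: the top letter is a POSITIVE perturbation, `F(t) = G(t) + t^{d₃}S₃ ⪰ G(t)`
in the Loewner order, so `λ₂(F(t)) ≥ λ₂(G(t))` — a middle-type det-root of `F` (its middle eigenvalue crossing zero) can only sit where the CORE `G(t)` has at most
one positive eigenvalue.  In the tree's eigenvalue-free currency:

* `gram_det_eq_cross_adjugate` — for ANY `3 × 3` matrix `A` over a commutative ring and any `p, q`: `(pᵀAp)(qᵀAq) − (pᵀAq)(qᵀAp) = (p × q)ᵀ adj(A) (p × q)`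
  (Cauchy–Binet for the `2 × 2` compression Gram matrix; the dual of `Census.adjugate_gram_fin_three`);
* `quadForm_two_grafts`, `bilin_two_grafts` — `pᵀ(G + s(vvᵀ+wwᵀ))q = pᵀGq + s((p·v)(q·v) + (p·w)(q·w))`; `gram_det_two_grafts_nonneg` — the Gram determinant of
  `vvᵀ + wwᵀ` on any frame is `((p·v)(q·w) − (p·w)(q·v))² ≥ 0` (Lagrange);
* `posDef_two_frame_add` — real `2 × 2` bookkeeping: a positive-definite frame Gram plus `s ≥ 0` times a positive-semidefinite one stays positive definite;
* **`coreShadow_middle`** — `G` real symmetric, `s ≥ 0`, `F = G + s·(vvᵀ + wwᵀ)` singular of MIDDLE type (`tr adj F < 0`): for all `p, q` with `0 < pᵀGp` the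
  frame Gram determinant `(pᵀGp)(qᵀGq) − (pᵀGq)²` is `≤ 0` — the core has no positive-definite 2-frame at a middle-type root (`λ₂(G(r)) ≤ 0`);
  **`coreShadow_middle_nonpos`** — the `S₃ ⪯ 0` half (`s ≤ 0`): no NEGATIVE-definite 2-frame of the core at a middle-type root;
* **`rankOneShadow_middle`**, **`rankOneShadows_middle`** — the tighter shadows `F ⪰ G + s·vvᵀ`, `F ⪰ G + s·wwᵀ`: at a middle-type root each rank-one graft
  pencil (`det = det G + t^{d₃} q_v`, a sixteen-nomial) has no positive-definite 2-frame;
* `nullTop_semidef_coreShadow` — the `(3,4)`-pencil form (top letter `S 3 = vvᵀ + wwᵀ`, any support, any real `t` with `0 ≤ t^{d₃}`);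
* §4 (rev 2) **`coreShadow_middle_upper`** — the UPPER sandwich `F ⪯ G + s·tr S₃·1` (`adjugate_trace_smul_one_sub_two_grafts`: `adj(μ·1 − vvᵀ − wwᵀ) =
  μ(vvᵀ + wwᵀ) + kkᵀ`, `gram_det_complement_nonneg`): at a middle-type root `G + s·tr S₃·1` has no negative-definite 2-frame, so `−s·tr S₃ ≤ λ₂(G(r)) ≤ 0`.

COUNTING READING (paper, for the line).  The middle-type det-roots of `F` lie in the closed set `{t : λ₂(G(t)) ≤ 0}` cut out by the THREE-LETTER core alone
(`d₃`-free); its boundary points are middle-type roots of `det G` (≤ 9), so it has at most five components; beyond the last core root it is all or nothing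
according to the inertia of `S₂`.  With …SheetSemidefBranches' habitat (positive-definite boundary roots only inside `{kᵀGk > 0}`, no negative-definite
boundary where the core has inertia `≤ 2`) this is the exact skeleton on which the located word `(−)^{Z−2}(+)²` of every semidefinite object of record sits.
Nothing here bounds any count; `DoorA34` and all three stubs stay OPEN; registers unchanged (`ζ_sym(3,4) ∈ {18,19}`); nothing on `MatrixDescartes`
(stmt-ValiantsHypothesis-18050) or `VP ≠ VNP` — VP≠VNP not moved.  [folklore] Cauchy–Binet, Loewner monotonicity of eigenvalues, the rank-one adjugate at a
singular symmetric matrix; `ring` / `nlinarith`.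
-/

-- `Summit.ValiantsHypothesis.ValiantsHypothesis.…` repeats a component by the D-0017 layout
-- (single-conjunct summit), which the `dupNamespace` linter flags; the name is mandated.
set_option linter.dupNamespace false

namespace Summit.ValiantsHypothesis.ValiantsHypothesis.Theorems.LacunarySymmetroidMatrixDescartes.Census

open scoped BigOperators Matrix
open Matrix

/-! ## 1. Cauchy–Binet for a `2`-frame and the two-graft Gram bookkeeping -/

/-- **Cauchy–Binet for a `2`-frame**: `(pᵀAp)(qᵀAq) − (pᵀAq)(qᵀAp) = (p × q)ᵀ adj(A) (p × q)` for any `3 × 3` matrix over a commutative ring. [folklore] -/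
theorem gram_det_eq_cross_adjugate {R : Type*} [CommRing R] (A : Matrix (Fin 3) (Fin 3) R) (p q : Fin 3 → R) :
    (p ⬝ᵥ (A *ᵥ p)) * (q ⬝ᵥ (A *ᵥ q)) - (p ⬝ᵥ (A *ᵥ q)) * (q ⬝ᵥ (A *ᵥ p))
      = (p ⨯₃ q) ⬝ᵥ (A.adjugate *ᵥ (p ⨯₃ q)) := by
  simp only [Matrix.adjugate_fin_three, Matrix.mulVec, dotProduct, Fin.sum_univ_three, Matrix.of_apply, Matrix.cons_val', Matrix.cons_val_zero,
    Matrix.cons_val_one, Matrix.head_cons, Matrix.cons_val_two, Matrix.tail_cons, Matrix.empty_val', Matrix.cons_val_fin_one, Matrix.head_fin_const,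
    cross_apply]
  ring

/-- The bilinear form of the two-graft letter: `pᵀ(G + s·(vvᵀ + wwᵀ))q = pᵀGq + s·((p·v)(q·v) + (p·w)(q·w))`. [folklore] -/
theorem bilin_two_grafts (G : Matrix (Fin 3) (Fin 3) ℝ) (s : ℝ) (v w p q : Fin 3 → ℝ) :
    p ⬝ᵥ ((G + s • (Matrix.vecMulVec v v + Matrix.vecMulVec w w)) *ᵥ q)
      = p ⬝ᵥ (G *ᵥ q) + s * ((p ⬝ᵥ v) * (q ⬝ᵥ v) + (p ⬝ᵥ w) * (q ⬝ᵥ w)) := by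
  simp only [Matrix.add_apply, Matrix.vecMulVec_apply, Matrix.smul_apply, smul_eq_mul, Matrix.mulVec, dotProduct, Fin.sum_univ_three]
  ring

/-- Lagrange's identity for the two-graft Gram determinant on a frame: it is a square, hence `≥ 0`. [folklore] -/
theorem gram_det_two_grafts_nonneg (v w p q : Fin 3 → ℝ) :
    0 ≤ ((p ⬝ᵥ v) * (p ⬝ᵥ v) + (p ⬝ᵥ w) * (p ⬝ᵥ w)) * ((q ⬝ᵥ v) * (q ⬝ᵥ v) + (q ⬝ᵥ w) * (q ⬝ᵥ w))
        - ((p ⬝ᵥ v) * (q ⬝ᵥ v) + (p ⬝ᵥ w) * (q ⬝ᵥ w)) ^ 2 := by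
  have h : ((p ⬝ᵥ v) * (p ⬝ᵥ v) + (p ⬝ᵥ w) * (p ⬝ᵥ w)) * ((q ⬝ᵥ v) * (q ⬝ᵥ v) + (q ⬝ᵥ w) * (q ⬝ᵥ w))
        - ((p ⬝ᵥ v) * (q ⬝ᵥ v) + (p ⬝ᵥ w) * (q ⬝ᵥ w)) ^ 2 = ((p ⬝ᵥ v) * (q ⬝ᵥ w) - (p ⬝ᵥ w) * (q ⬝ᵥ v)) ^ 2 := by ring
  rw [h]; positivity

/-- **`2 × 2` bookkeeping**: a positive-definite symmetric Gram `(a, b, c)` (`0 < a`, `0 < ac − b²`) plus `s ≥ 0` times a positive-semidefinite one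
(`0 ≤ a'`, `0 ≤ c'`, `0 ≤ a'c' − b'²`) is positive definite: `0 < (a + s a')(c + s c') − (b + s b')²`. [folklore] -/
theorem posDef_two_frame_add (a b c a' b' c' s : ℝ) (ha : 0 < a) (hdet : 0 < a * c - b ^ 2) (hs : 0 ≤ s)
    (ha' : 0 ≤ a') (hc' : 0 ≤ c') (hdet' : 0 ≤ a' * c' - b' ^ 2) :
    0 < (a + s * a') * (c + s * c') - (b + s * b') ^ 2 := by
  have hc : 0 < c := by nlinarith [sq_nonneg b]
  -- the mixed term `a c' + a' c − 2 b b'` is non-negative: `(a c' + a' c)² ≥ 4 a a' c c' ≥ 4 b² b'²` and `a c' + a' c ≥ 0`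
  have hmix_nonneg : 0 ≤ a * c' + a' * c := by positivity
  have h4 : 4 * (b ^ 2 * b' ^ 2) ≤ (a * c' + a' * c) ^ 2 := by
    have h1 : b ^ 2 * b' ^ 2 ≤ (a * c) * (a' * c') := by
      have := mul_le_mul (le_of_lt hdet) hdet' (by positivity) (by positivity)
      nlinarith [this, sq_nonneg b, sq_nonneg b', mul_nonneg (sq_nonneg b) hdet', mul_nonneg ha' hc']
    nlinarith [sq_nonneg (a * c' - a' * c), h1]
  have hmix : 2 * (b * b') ≤ a * c' + a' * c := by
    by_contra hlt
    have hlt' : a * c' + a' * c < 2 * (b * b') := not_le.mp hlt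
    have hpos : 0 < b * b' := by linarith
    nlinarith [hmix_nonneg, hlt', hpos, h4]
  have hexp : (a + s * a') * (c + s * c') - (b + s * b') ^ 2
      = (a * c - b ^ 2) + s * (a * c' + a' * c - 2 * (b * b')) + s ^ 2 * (a' * c' - b' ^ 2) := by ring
  rw [hexp]
  have h2 : 0 ≤ s * (a * c' + a' * c - 2 * (b * b')) := mul_nonneg hs (by linarith)
  have h3 : 0 ≤ s ^ 2 * (a' * c' - b' ^ 2) := mul_nonneg (sq_nonneg s) hdet'
  linarith

/-! ## 2. The CORE SHADOW at a middle-type root -/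

/-- **CORE SHADOW LAW (semidefinite top, `s ≥ 0`).**  `G` real symmetric, `F = G + s·(vvᵀ + wwᵀ)` with `det F = 0` and `tr adj F < 0` (a det-root of MIDDLE
type).  Then the core `G` has NO positive-definite `2`-frame: for all `p, q` with `0 < pᵀGp`, `(pᵀGp)(qᵀGq) − (pᵀGq)² ≤ 0`.  (If the frame Gram of `G` were
positive definite, so would be that of `F = G + s·S₃ ⪰ G`, whose determinant is `(p × q)ᵀ adj F (p × q)` by Cauchy–Binet — but every adjugate quadratic
form is `≤ 0` at a middle-type root.)  Eigenvalue reading: `λ₂(G(r)) ≤ 0` at every middle-type det-root `r` of the semidefinite sheet. [folklore] -/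
theorem coreShadow_middle (G : Matrix (Fin 3) (Fin 3) ℝ) (hG : G.IsSymm) (s : ℝ) (hs : 0 ≤ s) (v w : Fin 3 → ℝ)
    (hdet : (G + s • (Matrix.vecMulVec v v + Matrix.vecMulVec w w)).det = 0)
    (htype : (G + s • (Matrix.vecMulVec v v + Matrix.vecMulVec w w)).adjugate.trace < 0)
    (p q : Fin 3 → ℝ) (hp : 0 < p ⬝ᵥ (G *ᵥ p)) :
    (p ⬝ᵥ (G *ᵥ p)) * (q ⬝ᵥ (G *ᵥ q)) - (p ⬝ᵥ (G *ᵥ q)) ^ 2 ≤ 0 := by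
  set F := G + s • (Matrix.vecMulVec v v + Matrix.vecMulVec w w) with hF
  by_contra hlt
  have hdetG : 0 < (p ⬝ᵥ (G *ᵥ p)) * (q ⬝ᵥ (G *ᵥ q)) - (p ⬝ᵥ (G *ᵥ q)) ^ 2 := not_le.mp hlt
  -- the frame Gram of `F`
  have hFpp : p ⬝ᵥ (F *ᵥ p) = p ⬝ᵥ (G *ᵥ p) + s * ((p ⬝ᵥ v) * (p ⬝ᵥ v) + (p ⬝ᵥ w) * (p ⬝ᵥ w)) := bilin_two_grafts G s v w p p
  have hFqq : q ⬝ᵥ (F *ᵥ q) = q ⬝ᵥ (G *ᵥ q) + s * ((q ⬝ᵥ v) * (q ⬝ᵥ v) + (q ⬝ᵥ w) * (q ⬝ᵥ w)) := bilin_two_grafts G s v w q q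
  have hFpq : p ⬝ᵥ (F *ᵥ q) = p ⬝ᵥ (G *ᵥ q) + s * ((p ⬝ᵥ v) * (q ⬝ᵥ v) + (p ⬝ᵥ w) * (q ⬝ᵥ w)) := bilin_two_grafts G s v w p q
  have hFqp : q ⬝ᵥ (F *ᵥ p) = p ⬝ᵥ (F *ᵥ q) := by
    have hFs : F.IsSymm := isSymm_add_two_grafts G hG s v w
    rw [dotProduct_mulVec, ← Matrix.mulVec_transpose, hFs.eq, dotProduct_comm]
  have hGqp : q ⬝ᵥ (G *ᵥ p) = p ⬝ᵥ (G *ᵥ q) := by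
    rw [dotProduct_mulVec, ← Matrix.mulVec_transpose, hG.eq, dotProduct_comm]
  -- it is positive definite: `posDef_two_frame_add`
  have hpos := posDef_two_frame_add (p ⬝ᵥ (G *ᵥ p)) (p ⬝ᵥ (G *ᵥ q)) (q ⬝ᵥ (G *ᵥ q))
    ((p ⬝ᵥ v) * (p ⬝ᵥ v) + (p ⬝ᵥ w) * (p ⬝ᵥ w)) ((p ⬝ᵥ v) * (q ⬝ᵥ v) + (p ⬝ᵥ w) * (q ⬝ᵥ w)) ((q ⬝ᵥ v) * (q ⬝ᵥ v) + (q ⬝ᵥ w) * (q ⬝ᵥ w))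
    s hp hdetG hs (add_nonneg (mul_self_nonneg _) (mul_self_nonneg _)) (add_nonneg (mul_self_nonneg _) (mul_self_nonneg _))
    (gram_det_two_grafts_nonneg v w p q)
  -- and its determinant is the adjugate form of `F` at `p × q`, which is `≤ 0` at a middle-type root
  have hcb := gram_det_eq_cross_adjugate F p q
  rw [hFqp] at hcb
  have hadj := quadForm_adjugate_nonpos_of_trace_adjugate_neg F (isSymm_add_two_grafts G hG s v w) hdet htype (p ⨯₃ q)
  rw [← hcb, hFpp, hFqq, hFpq] at hadj
  nlinarith [hadj, hpos]

/-- **CORE SHADOW, the `S₃ ⪯ 0` half (`s ≤ 0`).**  At a middle-type det-root of `G + s·(vvᵀ + wwᵀ)` with `s ≤ 0` the core has NO negative-definite `2`-frame: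
`pᵀGp < 0 ⇒ (pᵀGp)(qᵀGq) − (pᵀGq)² ≤ 0` (`λ₂(G(r)) ≥ 0`). [folklore] -/
theorem coreShadow_middle_nonpos (G : Matrix (Fin 3) (Fin 3) ℝ) (hG : G.IsSymm) (s : ℝ) (hs : s ≤ 0) (v w : Fin 3 → ℝ)
    (hdet : (G + s • (Matrix.vecMulVec v v + Matrix.vecMulVec w w)).det = 0)
    (htype : (G + s • (Matrix.vecMulVec v v + Matrix.vecMulVec w w)).adjugate.trace < 0)
    (p q : Fin 3 → ℝ) (hp : p ⬝ᵥ (G *ᵥ p) < 0) :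
    (p ⬝ᵥ (G *ᵥ p)) * (q ⬝ᵥ (G *ᵥ q)) - (p ⬝ᵥ (G *ᵥ q)) ^ 2 ≤ 0 := by
  -- apply the `s ≥ 0` law to `−G` and `−s`: `−F = (−G) + (−s)·S₃` has the same determinant (up to sign: `det(−F) = −det F = 0`) and `adj(−F) = adj F`
  have hnegF : (-G) + (-s) • (Matrix.vecMulVec v v + Matrix.vecMulVec w w) = -(G + s • (Matrix.vecMulVec v v + Matrix.vecMulVec w w)) := by
    rw [neg_smul, neg_add]
  have hdet' : ((-G) + (-s) • (Matrix.vecMulVec v v + Matrix.vecMulVec w w)).det = 0 := by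
    rw [hnegF, Matrix.det_neg, hdet, mul_zero]
  have hadj' : ((-G) + (-s) • (Matrix.vecMulVec v v + Matrix.vecMulVec w w)).adjugate
      = (G + s • (Matrix.vecMulVec v v + Matrix.vecMulVec w w)).adjugate := by
    rw [hnegF, ← neg_one_smul ℝ (G + s • (Matrix.vecMulVec v v + Matrix.vecMulVec w w)), Matrix.adjugate_smul, Fintype.card_fin]
    norm_num
  have htype' : ((-G) + (-s) • (Matrix.vecMulVec v v + Matrix.vecMulVec w w)).adjugate.trace < 0 := by
    rw [hadj']; exact htype
  have hGn : (-G).IsSymm := hG.neg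
  have hp' : 0 < p ⬝ᵥ ((-G) *ᵥ p) := by rw [Matrix.neg_mulVec, dotProduct_neg]; linarith
  have h := coreShadow_middle (-G) hGn (-s) (by linarith) v w hdet' htype' p q hp'
  simp only [Matrix.neg_mulVec, dotProduct_neg] at h
  nlinarith [h]

/-! ## 2b. The RANK-ONE SHADOWS (tighter): `F = (G + s·wwᵀ) + s·vvᵀ ⪰ G + s·wwᵀ` and symmetrically -/

/-- The bilinear form of a one-graft letter: `pᵀ(M + s·wwᵀ)q = pᵀMq + s·(p·w)(q·w)`. [folklore] -/
theorem bilin_one_graft (M : Matrix (Fin 3) (Fin 3) ℝ) (s : ℝ) (w p q : Fin 3 → ℝ) :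
    p ⬝ᵥ ((M + s • Matrix.vecMulVec w w) *ᵥ q) = p ⬝ᵥ (M *ᵥ q) + s * ((p ⬝ᵥ w) * (q ⬝ᵥ w)) := by
  simp only [Matrix.add_apply, Matrix.vecMulVec_apply, Matrix.smul_apply, smul_eq_mul, Matrix.mulVec, dotProduct, Fin.sum_univ_three]
  ring

/-- **RANK-ONE SHADOW LAW**: `M` real symmetric, `s ≥ 0`, `F = M + s·wwᵀ` singular of MIDDLE type (`tr adj F < 0`) ⇒ `M` has no positive-definite `2`-frame
(`0 < pᵀMp ⇒ (pᵀMp)(qᵀMq) − (pᵀMq)² ≤ 0`, i.e. `λ₂(M) ≤ 0`).  On the semidefinite sheet, with `M = G + s·vvᵀ` (resp. `G + s·wwᵀ`): the middle-type det-roots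
of `F = G + s·(vvᵀ + wwᵀ)` lie inside the shadow `{λ₂ ≤ 0}` of EACH rank-one graft pencil `G + t^{d₃}·vvᵀ`, `G + t^{d₃}·wwᵀ` (sixteen-nomial determinants
`det G + t^{d₃} q_v`, `det G + t^{d₃} q_w`; the near-rank-one regime's «rank-one truncation»). [folklore] -/
theorem rankOneShadow_middle (M : Matrix (Fin 3) (Fin 3) ℝ) (hM : M.IsSymm) (s : ℝ) (hs : 0 ≤ s) (w : Fin 3 → ℝ)
    (hdet : (M + s • Matrix.vecMulVec w w).det = 0) (htype : (M + s • Matrix.vecMulVec w w).adjugate.trace < 0)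
    (p q : Fin 3 → ℝ) (hp : 0 < p ⬝ᵥ (M *ᵥ p)) :
    (p ⬝ᵥ (M *ᵥ p)) * (q ⬝ᵥ (M *ᵥ q)) - (p ⬝ᵥ (M *ᵥ q)) ^ 2 ≤ 0 := by
  set F := M + s • Matrix.vecMulVec w w with hF
  by_contra hlt
  have hdetM : 0 < (p ⬝ᵥ (M *ᵥ p)) * (q ⬝ᵥ (M *ᵥ q)) - (p ⬝ᵥ (M *ᵥ q)) ^ 2 := not_le.mp hlt
  have hFs : F.IsSymm := by
    unfold Matrix.IsSymm at hM ⊢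
    rw [hF, Matrix.transpose_add, Matrix.transpose_smul, Matrix.transpose_vecMulVec, hM]
  have hFpp : p ⬝ᵥ (F *ᵥ p) = p ⬝ᵥ (M *ᵥ p) + s * ((p ⬝ᵥ w) * (p ⬝ᵥ w)) := bilin_one_graft M s w p p
  have hFqq : q ⬝ᵥ (F *ᵥ q) = q ⬝ᵥ (M *ᵥ q) + s * ((q ⬝ᵥ w) * (q ⬝ᵥ w)) := bilin_one_graft M s w q q
  have hFpq : p ⬝ᵥ (F *ᵥ q) = p ⬝ᵥ (M *ᵥ q) + s * ((p ⬝ᵥ w) * (q ⬝ᵥ w)) := bilin_one_graft M s w p q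
  have hFqp : q ⬝ᵥ (F *ᵥ p) = p ⬝ᵥ (F *ᵥ q) := by
    rw [dotProduct_mulVec, ← Matrix.mulVec_transpose, hFs.eq, dotProduct_comm]
  have hpos := posDef_two_frame_add (p ⬝ᵥ (M *ᵥ p)) (p ⬝ᵥ (M *ᵥ q)) (q ⬝ᵥ (M *ᵥ q))
    ((p ⬝ᵥ w) * (p ⬝ᵥ w)) ((p ⬝ᵥ w) * (q ⬝ᵥ w)) ((q ⬝ᵥ w) * (q ⬝ᵥ w))
    s hp hdetM hs (mul_self_nonneg _) (mul_self_nonneg _) (by nlinarith [sq_nonneg ((p ⬝ᵥ w) * (q ⬝ᵥ w))])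
  have hcb := gram_det_eq_cross_adjugate F p q
  rw [hFqp] at hcb
  have hadj := quadForm_adjugate_nonpos_of_trace_adjugate_neg F hFs hdet htype (p ⨯₃ q)
  rw [← hcb, hFpp, hFqq, hFpq] at hadj
  nlinarith [hadj, hpos]

/-- The two-graft letter split off one graft: `G + s·(vvᵀ + wwᵀ) = (G + s·wwᵀ) + s·vvᵀ`. [folklore] -/
theorem two_grafts_split_left (G : Matrix (Fin 3) (Fin 3) ℝ) (s : ℝ) (v w : Fin 3 → ℝ) :
    G + s • (Matrix.vecMulVec v v + Matrix.vecMulVec w w) = (G + s • Matrix.vecMulVec w w) + s • Matrix.vecMulVec v v := by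
  rw [smul_add]; abel

/-- The two-graft letter split off the other graft: `G + s·(vvᵀ + wwᵀ) = (G + s·vvᵀ) + s·wwᵀ`. [folklore] -/
theorem two_grafts_split_right (G : Matrix (Fin 3) (Fin 3) ℝ) (s : ℝ) (v w : Fin 3 → ℝ) :
    G + s • (Matrix.vecMulVec v v + Matrix.vecMulVec w w) = (G + s • Matrix.vecMulVec v v) + s • Matrix.vecMulVec w w := by
  rw [smul_add, add_assoc]

/-- Symmetry of a one-graft matrix. [folklore] -/
theorem isSymm_add_one_graft (G : Matrix (Fin 3) (Fin 3) ℝ) (hG : G.IsSymm) (s : ℝ) (v : Fin 3 → ℝ) :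
    (G + s • Matrix.vecMulVec v v).IsSymm := by
  unfold Matrix.IsSymm at hG ⊢
  rw [Matrix.transpose_add, Matrix.transpose_smul, Matrix.transpose_vecMulVec, hG]

/-- **RANK-ONE SHADOWS ON THE SEMIDEFINITE SHEET**: at a middle-type det-root of `F = G + s·(vvᵀ + wwᵀ)` (`s ≥ 0`) BOTH rank-one graft pencils
`G + s·vvᵀ` and `G + s·wwᵀ` have no positive-definite `2`-frame (`λ₂ ≤ 0` for each). [folklore] -/
theorem rankOneShadows_middle (G : Matrix (Fin 3) (Fin 3) ℝ) (hG : G.IsSymm) (s : ℝ) (hs : 0 ≤ s) (v w : Fin 3 → ℝ)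
    (hdet : (G + s • (Matrix.vecMulVec v v + Matrix.vecMulVec w w)).det = 0)
    (htype : (G + s • (Matrix.vecMulVec v v + Matrix.vecMulVec w w)).adjugate.trace < 0) (p q : Fin 3 → ℝ) :
    (0 < p ⬝ᵥ ((G + s • Matrix.vecMulVec v v) *ᵥ p) →
      (p ⬝ᵥ ((G + s • Matrix.vecMulVec v v) *ᵥ p)) * (q ⬝ᵥ ((G + s • Matrix.vecMulVec v v) *ᵥ q))
        - (p ⬝ᵥ ((G + s • Matrix.vecMulVec v v) *ᵥ q)) ^ 2 ≤ 0) ∧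
    (0 < p ⬝ᵥ ((G + s • Matrix.vecMulVec w w) *ᵥ p) →
      (p ⬝ᵥ ((G + s • Matrix.vecMulVec w w) *ᵥ p)) * (q ⬝ᵥ ((G + s • Matrix.vecMulVec w w) *ᵥ q))
        - (p ⬝ᵥ ((G + s • Matrix.vecMulVec w w) *ᵥ q)) ^ 2 ≤ 0) := by
  constructor
  · intro hp
    rw [two_grafts_split_right] at hdet htype
    exact rankOneShadow_middle _ (isSymm_add_one_graft G hG s v) s hs w hdet htype p q hp
  · intro hp
    rw [two_grafts_split_left] at hdet htype
    exact rankOneShadow_middle _ (isSymm_add_one_graft G hG s w) s hs v hdet htype p q hp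

/-! ## 3. The sheet reading -/

/-- **CORE SHADOW ON THE SEMIDEFINITE SHEET** (all supports).  A real symmetric `(3,4)` pencil with top letter `S₃ = vvᵀ + wwᵀ`, a real `t` with
`0 ≤ t^{d₃}` (e.g. `t > 0`), `det F(t) = 0` of MIDDLE type (`tr adj F(t) < 0`): the three-letter core `G(t) = Σ_{l<3} t^{d_l} S_l` has no positive-definite
`2`-frame — `0 < pᵀG(t)p ⇒ (pᵀG(t)p)(qᵀG(t)q) − (pᵀG(t)q)² ≤ 0`.  So the middle-type det-roots of the sheet pencil lie in the `d₃`-free closed set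
`{λ₂(G) ≤ 0}` of the core. [folklore] -/
theorem nullTop_semidef_coreShadow (d : Fin 4 → ℕ) (S : Fin 4 → Matrix (Fin 3) (Fin 3) ℝ) (hS : ∀ l, (S l).IsSymm) (v w : Fin 3 → ℝ)
    (h3 : S 3 = Matrix.vecMulVec v v + Matrix.vecMulVec w w) (t : ℝ) (ht : 0 ≤ t ^ d 3) (hdet : (∑ l, t ^ d l • S l).det = 0)
    (htype : (∑ l, t ^ d l • S l).adjugate.trace < 0) (p q : Fin 3 → ℝ)
    (hp : 0 < p ⬝ᵥ ((∑ l : Fin 3, t ^ d (Fin.castSucc l) • S (Fin.castSucc l)) *ᵥ p)) :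
    (p ⬝ᵥ ((∑ l : Fin 3, t ^ d (Fin.castSucc l) • S (Fin.castSucc l)) *ᵥ p))
        * (q ⬝ᵥ ((∑ l : Fin 3, t ^ d (Fin.castSucc l) • S (Fin.castSucc l)) *ᵥ q))
      - (p ⬝ᵥ ((∑ l : Fin 3, t ^ d (Fin.castSucc l) • S (Fin.castSucc l)) *ᵥ q)) ^ 2 ≤ 0 := by
  have hG : (∑ l : Fin 3, t ^ d (Fin.castSucc l) • S (Fin.castSucc l)).IsSymm := by
    unfold Matrix.IsSymm
    rw [Matrix.transpose_sum]
    refine Finset.sum_congr rfl fun l _ => ?_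
    rw [Matrix.transpose_smul, (hS _)]
  rw [eval_pencil_two_grafts d S v w h3 t] at hdet htype
  exact coreShadow_middle _ hG _ ht v w hdet htype p q hp

/-! ## 4. The UPPER sandwich (appended, rev 2): `F ⪯ G + s·(|v|² + |w|²)·1`, so at a middle-type root the core's middle eigenvalue is within `s·tr S₃` of `0`

With `μ := v·v + w·w = tr S₃` and `Y := μ·1 − (vvᵀ + wwᵀ) ⪰ 0` (Cauchy–Schwarz), `G + sμ·1 = F + s·Y ⪰ F`.  The adjugate of `Y` is EXPLICITLY positive:
`adj(μ·1 − vvᵀ − wwᵀ) = μ·(vvᵀ + wwᵀ) + kkᵀ` (`k = v × w`), so the frame Gram of `Y` is positive semidefinite by Cauchy–Binet; hence a negative-definite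
2-frame of `G + sμ·1` would be one of `F`, impossible at a middle-type root (every adjugate form of `F` is `≤ 0` there).  Together with `coreShadow_middle`:
`−s·tr S₃ ≤ λ₂(G(r)) ≤ 0` at every middle-type det-root `r` — the exact CORE ATTACHMENT of the semidefinite sheet (in the core window `s = r^{d₃}` is tiny). -/

/-- **Adjugate of the complement of the two grafts**: `adj((v·v + w·w)·1 − vvᵀ − wwᵀ) = (v·v + w·w)·(vvᵀ + wwᵀ) + kkᵀ`, `k = v × w` (any commutative ring).
[folklore] -/
theorem adjugate_trace_smul_one_sub_two_grafts {R : Type*} [CommRing R] (v w : Fin 3 → R) :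
    ((v ⬝ᵥ v + w ⬝ᵥ w) • (1 : Matrix (Fin 3) (Fin 3) R) - Matrix.vecMulVec v v - Matrix.vecMulVec w w).adjugate
      = (v ⬝ᵥ v + w ⬝ᵥ w) • (Matrix.vecMulVec v v + Matrix.vecMulVec w w) + Matrix.vecMulVec (v ⨯₃ w) (v ⨯₃ w) := by
  ext i j
  fin_cases i <;> fin_cases j <;>
  · simp only [Matrix.adjugate_fin_three, Matrix.sub_apply, Matrix.add_apply, Matrix.smul_apply, Matrix.one_apply, Matrix.vecMulVec_apply,
      smul_eq_mul, dotProduct, Fin.sum_univ_three, Matrix.of_apply, Matrix.cons_val', Matrix.cons_val_zero, Matrix.cons_val_one, Matrix.head_cons,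
      Matrix.cons_val_two, Matrix.tail_cons, Matrix.empty_val', Matrix.cons_val_fin_one, Matrix.head_fin_const, cross_apply, Fin.isValue,
      Fin.zero_eta, Fin.mk_one, Fin.reduceFinMk, if_true, one_ne_zero, zero_ne_one, if_false, Fin.reduceEq]
    ring

/-- The bilinear form of `G + c·1`: `pᵀ(G + c·1)q = pᵀGq + c·(p·q)`. [folklore] -/
theorem bilin_add_smul_one (G : Matrix (Fin 3) (Fin 3) ℝ) (c : ℝ) (p q : Fin 3 → ℝ) :
    p ⬝ᵥ ((G + c • (1 : Matrix (Fin 3) (Fin 3) ℝ)) *ᵥ q) = p ⬝ᵥ (G *ᵥ q) + c * (p ⬝ᵥ q) := by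
  simp only [Matrix.add_apply, Matrix.smul_apply, Matrix.one_apply, smul_eq_mul, Matrix.mulVec, dotProduct, Fin.sum_univ_three, Fin.isValue,
    if_true, one_ne_zero, zero_ne_one, if_false, Fin.reduceEq]
  ring

/-- The complement form `Y = μ·1 − vvᵀ − wwᵀ` (`μ = v·v + w·w`) is non-negative on every vector: `(p·v)² + (p·w)² ≤ μ·(p·p)` (Cauchy–Schwarz on
`Fin 3` via Lagrange's identity `cross_dot_cross`; cf. `Literature.Geometry.Riemannian.HamiltonODE.dot_sq_le`). [folklore] -/
theorem two_grafts_le_trace (v w p : Fin 3 → ℝ) :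
    (p ⬝ᵥ v) * (p ⬝ᵥ v) + (p ⬝ᵥ w) * (p ⬝ᵥ w) ≤ (v ⬝ᵥ v + w ⬝ᵥ w) * (p ⬝ᵥ p) := by
  have hcs : ∀ u : Fin 3 → ℝ, (p ⬝ᵥ u) * (p ⬝ᵥ u) ≤ (p ⬝ᵥ p) * (u ⬝ᵥ u) := by
    intro u
    have h := cross_dot_cross p u p u
    have hnn : 0 ≤ p ⨯₃ u ⬝ᵥ p ⨯₃ u := by
      simp only [dotProduct, Fin.sum_univ_three]
      nlinarith [mul_self_nonneg ((p ⨯₃ u) 0), mul_self_nonneg ((p ⨯₃ u) 1), mul_self_nonneg ((p ⨯₃ u) 2)]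
    rw [h, dotProduct_comm u p] at hnn
    nlinarith [hnn]
  nlinarith [hcs v, hcs w]

/-- The frame Gram determinant of the complement form `Y` is `≥ 0` (Cauchy–Binet + the explicit positive adjugate of `Y`). [folklore] -/
theorem gram_det_complement_nonneg (v w p q : Fin 3 → ℝ) :
    0 ≤ ((v ⬝ᵥ v + w ⬝ᵥ w) * (p ⬝ᵥ p) - ((p ⬝ᵥ v) * (p ⬝ᵥ v) + (p ⬝ᵥ w) * (p ⬝ᵥ w)))
          * ((v ⬝ᵥ v + w ⬝ᵥ w) * (q ⬝ᵥ q) - ((q ⬝ᵥ v) * (q ⬝ᵥ v) + (q ⬝ᵥ w) * (q ⬝ᵥ w)))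
        - ((v ⬝ᵥ v + w ⬝ᵥ w) * (p ⬝ᵥ q) - ((p ⬝ᵥ v) * (q ⬝ᵥ v) + (p ⬝ᵥ w) * (q ⬝ᵥ w))) ^ 2 := by
  set Y : Matrix (Fin 3) (Fin 3) ℝ := (v ⬝ᵥ v + w ⬝ᵥ w) • (1 : Matrix (Fin 3) (Fin 3) ℝ) - Matrix.vecMulVec v v - Matrix.vecMulVec w w with hY
  have hbil : ∀ a b : Fin 3 → ℝ, a ⬝ᵥ (Y *ᵥ b) = (v ⬝ᵥ v + w ⬝ᵥ w) * (a ⬝ᵥ b) - ((a ⬝ᵥ v) * (b ⬝ᵥ v) + (a ⬝ᵥ w) * (b ⬝ᵥ w)) := by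
    intro a b
    simp only [hY, Matrix.sub_apply, Matrix.smul_apply, Matrix.one_apply, Matrix.vecMulVec_apply, smul_eq_mul, Matrix.mulVec, dotProduct,
      Fin.sum_univ_three, Fin.isValue, if_true, one_ne_zero, zero_ne_one, if_false, Fin.reduceEq]
    ring
  have hcb := gram_det_eq_cross_adjugate Y p q
  rw [hbil p p, hbil q q, hbil p q, hbil q p] at hcb
  have hadj : (p ⨯₃ q) ⬝ᵥ (Y.adjugate *ᵥ (p ⨯₃ q))
      = (v ⬝ᵥ v + w ⬝ᵥ w) * (((p ⨯₃ q) ⬝ᵥ v) * ((p ⨯₃ q) ⬝ᵥ v) + ((p ⨯₃ q) ⬝ᵥ w) * ((p ⨯₃ q) ⬝ᵥ w))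
        + ((p ⨯₃ q) ⬝ᵥ (v ⨯₃ w)) * ((p ⨯₃ q) ⬝ᵥ (v ⨯₃ w)) := by
    rw [hY, adjugate_trace_smul_one_sub_two_grafts]
    simp only [Matrix.add_apply, Matrix.smul_apply, Matrix.vecMulVec_apply, smul_eq_mul, Matrix.mulVec, dotProduct, Fin.sum_univ_three, cross_apply]
    ring
  have hnn : 0 ≤ (p ⨯₃ q) ⬝ᵥ (Y.adjugate *ᵥ (p ⨯₃ q)) := by
    rw [hadj]
    have hμ : 0 ≤ v ⬝ᵥ v + w ⬝ᵥ w := by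
      simp only [dotProduct, Fin.sum_univ_three]; nlinarith [mul_self_nonneg (v 0), mul_self_nonneg (v 1), mul_self_nonneg (v 2),
        mul_self_nonneg (w 0), mul_self_nonneg (w 1), mul_self_nonneg (w 2)]
    nlinarith [mul_nonneg hμ (add_nonneg (mul_self_nonneg ((p ⨯₃ q) ⬝ᵥ v)) (mul_self_nonneg ((p ⨯₃ q) ⬝ᵥ w))),
      mul_self_nonneg ((p ⨯₃ q) ⬝ᵥ (v ⨯₃ w))]
  have hsym : (v ⬝ᵥ v + w ⬝ᵥ w) * (q ⬝ᵥ p) - ((q ⬝ᵥ v) * (p ⬝ᵥ v) + (q ⬝ᵥ w) * (p ⬝ᵥ w))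
      = (v ⬝ᵥ v + w ⬝ᵥ w) * (p ⬝ᵥ q) - ((p ⬝ᵥ v) * (q ⬝ᵥ v) + (p ⬝ᵥ w) * (q ⬝ᵥ w)) := by rw [dotProduct_comm q p]; ring
  rw [hsym] at hcb
  nlinarith [hcb, hnn]

/-- **UPPER CORE SHADOW (semidefinite top, `s ≥ 0`).**  `G` real symmetric, `F = G + s·(vvᵀ + wwᵀ)` singular of MIDDLE type, `μ = v·v + w·w = tr S₃`.
Then `G + sμ·1` has NO negative-definite 2-frame: `pᵀ(G + sμ·1)p < 0 ⇒` its frame Gram determinant on `(p, q)` is `≤ 0` — i.e. `λ₂(G(r)) ≥ −s·tr S₃`.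
With `coreShadow_middle`: `−r^{d₃}·tr S₃ ≤ λ₂(G(r)) ≤ 0` at every middle-type det-root of the semidefinite sheet (exact core attachment). [folklore] -/
theorem coreShadow_middle_upper (G : Matrix (Fin 3) (Fin 3) ℝ) (hG : G.IsSymm) (s : ℝ) (hs : 0 ≤ s) (v w : Fin 3 → ℝ)
    (hdet : (G + s • (Matrix.vecMulVec v v + Matrix.vecMulVec w w)).det = 0)
    (htype : (G + s • (Matrix.vecMulVec v v + Matrix.vecMulVec w w)).adjugate.trace < 0)
    (p q : Fin 3 → ℝ) (hp : p ⬝ᵥ ((G + (s * (v ⬝ᵥ v + w ⬝ᵥ w)) • (1 : Matrix (Fin 3) (Fin 3) ℝ)) *ᵥ p) < 0) :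
    (p ⬝ᵥ ((G + (s * (v ⬝ᵥ v + w ⬝ᵥ w)) • (1 : Matrix (Fin 3) (Fin 3) ℝ)) *ᵥ p))
        * (q ⬝ᵥ ((G + (s * (v ⬝ᵥ v + w ⬝ᵥ w)) • (1 : Matrix (Fin 3) (Fin 3) ℝ)) *ᵥ q))
      - (p ⬝ᵥ ((G + (s * (v ⬝ᵥ v + w ⬝ᵥ w)) • (1 : Matrix (Fin 3) (Fin 3) ℝ)) *ᵥ q)) ^ 2 ≤ 0 := by
  set F := G + s • (Matrix.vecMulVec v v + Matrix.vecMulVec w w) with hF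
  set μ := v ⬝ᵥ v + w ⬝ᵥ w with hμ
  by_contra hlt
  have hdetH : 0 < (p ⬝ᵥ ((G + (s * μ) • (1 : Matrix (Fin 3) (Fin 3) ℝ)) *ᵥ p)) * (q ⬝ᵥ ((G + (s * μ) • (1 : Matrix (Fin 3) (Fin 3) ℝ)) *ᵥ q))
      - (p ⬝ᵥ ((G + (s * μ) • (1 : Matrix (Fin 3) (Fin 3) ℝ)) *ᵥ q)) ^ 2 := not_le.mp hlt
  -- frame entries of `H = G + sμ·1` and of `F = G + s S₃`; `H = F + s·Y`
  rw [bilin_add_smul_one] at hp hdetH; rw [bilin_add_smul_one, bilin_add_smul_one] at hdetH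
  have hFpp := bilin_two_grafts G s v w p p
  have hFqq := bilin_two_grafts G s v w q q
  have hFpq := bilin_two_grafts G s v w p q
  have hGqp : q ⬝ᵥ (G *ᵥ p) = p ⬝ᵥ (G *ᵥ q) := by
    rw [dotProduct_mulVec, ← Matrix.mulVec_transpose, hG.eq, dotProduct_comm]
  have hFs : F.IsSymm := isSymm_add_two_grafts G hG s v w
  have hFqp : q ⬝ᵥ (F *ᵥ p) = p ⬝ᵥ (F *ᵥ q) := by
    rw [dotProduct_mulVec, ← Matrix.mulVec_transpose, hFs.eq, dotProduct_comm]
  -- the frame Gram of `−H` is positive definite; `−F = −H + s·Y` with `Y`'s Gram PSD ⇒ the frame Gram of `−F` is positive definite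
  have hpos := posDef_two_frame_add (-(p ⬝ᵥ (G *ᵥ p) + s * μ * (p ⬝ᵥ p))) (-(p ⬝ᵥ (G *ᵥ q) + s * μ * (p ⬝ᵥ q))) (-(q ⬝ᵥ (G *ᵥ q) + s * μ * (q ⬝ᵥ q)))
    (μ * (p ⬝ᵥ p) - ((p ⬝ᵥ v) * (p ⬝ᵥ v) + (p ⬝ᵥ w) * (p ⬝ᵥ w))) (μ * (p ⬝ᵥ q) - ((p ⬝ᵥ v) * (q ⬝ᵥ v) + (p ⬝ᵥ w) * (q ⬝ᵥ w)))
    (μ * (q ⬝ᵥ q) - ((q ⬝ᵥ v) * (q ⬝ᵥ v) + (q ⬝ᵥ w) * (q ⬝ᵥ w))) s (by linarith) (by nlinarith [hdetH]) hs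
    (by nlinarith [two_grafts_le_trace v w p]) (by nlinarith [two_grafts_le_trace v w q]) (gram_det_complement_nonneg v w p q)
  -- Cauchy–Binet for `F` and the type law
  have hcb := gram_det_eq_cross_adjugate F p q
  rw [hFqp] at hcb
  have hadj := quadForm_adjugate_nonpos_of_trace_adjugate_neg F hFs hdet htype (p ⨯₃ q)
  rw [← hcb, hFpp, hFqq, hFpq] at hadj
  nlinarith [hadj, hpos]

end Summit.ValiantsHypothesis.ValiantsHypothesis.Theorems.LacunarySymmetroidMatrixDescartes.Census
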